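import Mathlib
import Literature.ModelTheory.ExponentialFields.DefinabilityParams
import Summits.Schanuel.Schanuel.Theorems.RigidCoreMinimalCounterexampleInAclHitSetArithmeticalRingDef

/-!
# Graphs of partial recursive functions inside `ℤ²`: the eight closure steps as SET IDENTITIES
# (crux stmt-Schanuel-0969 `RigidCore.MinimalCounterexampleInAcl`, line kernel-arithmetic-selection, stub S8)

`--supports stmt-Schanuel-0969`; second layer of the representability theorem feeding the registered stub
`stub_corankOne_hitSetArithmetical` (companion of `…HitSetArithmeticalRingDef.lean`, p133561).

For a partial function `f : ℕ →. ℕ` its GRAPH INSIDE `ℤ²` is the set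
`Γ[f] = {v : Fin 2 → ℤ | 0 ≤ v 0 ∧ 0 ≤ v 1 ∧ (v 1).toNat ∈ f (v 0).toNat}` (local notation; no new definitions).  For each
constructor of Mathlib's `Nat.Partrec` (zero, succ, left, right, pair, comp, prec, rfind) this file proves that the graph of the
compound function EQUALS a set written with `∃/∀` over `ℤ`, the order, the pairing graph
`ΓP = {(a, b, Nat.pair a b)}`, Gödel's β-graph `Γβ = {(c, i, Nat.beta c i)}` and the graphs of the constituents — i.e. the
semantic content of Gödel's proof that recursive relations are arithmetical (Gödel 1931, Satz VII; Kleene's extension to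
μ-recursion), with primitive recursion unwound through the β-function (`mem_prec_iff`, `mem_prec_iff_beta`, using
`exists_beta_eq`).  The definability conclusions are drawn in `…HitSetArithmeticalRepresentability.lean`.

References: K. Gödel, Monatsh. Math. Phys. 38 (1931) 173–198, Satz VII; S. C. Kleene, *Introduction to Metamathematics* (1952),
§§ 48–49, 57; R. Kaye, *Models of Peano Arithmetic* (1991), §3.1.
-/

-- the summit namespace `Summit.Schanuel.Schanuel.…` repeats a component by design (D-0022)
set_option linter.dupNamespace false

open Set

namespace Summit.Schanuel.Schanuel.Cruxes.MinimalCounterexampleInAcl.KernelArithmeticSelection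

/-! ## Membership in the basic graphs at natural arguments -/

/-- `(a, b, z) ∈ ΓP ↔ z = Nat.pair a b` for naturals `a, b`. -/
theorem natCast_mem_pairGraph (a b : ℕ) (z : ℤ) : (![(a : ℤ), (b : ℤ), z] ∈ {t : Fin 3 → ℤ | 0 ≤ t 0 ∧ 0 ≤ t 1 ∧ t 2 = (Nat.pair (t 0).toNat (t 1).toNat : ℤ)}) ↔ z = Nat.pair a b := by
  simp

/-- `(c, i, z) ∈ Γβ ↔ z = Nat.beta c i` for naturals `c, i`. -/
theorem natCast_mem_betaGraph (c i : ℕ) (z : ℤ) : (![(c : ℤ), (i : ℤ), z] ∈ {t : Fin 3 → ℤ | 0 ≤ t 0 ∧ 0 ≤ t 1 ∧ t 2 = (Nat.beta (t 0).toNat (t 1).toNat : ℤ)}) ↔ z = Nat.beta c i := by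
  simp

/-- `(a, z) ∈ Γ[f] ↔ 0 ≤ z ∧ z.toNat ∈ f a` for a natural `a`. -/
theorem natCast_mem_graph (f : ℕ →. ℕ) (a : ℕ) (z : ℤ) : (![(a : ℤ), z] ∈ {t : Fin 2 → ℤ | 0 ≤ t 0 ∧ 0 ≤ t 1 ∧ (t 1).toNat ∈ f (t 0).toNat}) ↔ 0 ≤ z ∧ z.toNat ∈ f a := by
  simp

/-- `(a, b) ∈ Γ[f] ↔ b ∈ f a` for naturals `a, b`. -/
theorem natCast_natCast_mem_graph (f : ℕ →. ℕ) (a b : ℕ) : (![(a : ℤ), (b : ℤ)] ∈ {t : Fin 2 → ℤ | 0 ≤ t 0 ∧ 0 ≤ t 1 ∧ (t 1).toNat ∈ f (t 0).toNat}) ↔ b ∈ f a := by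
  simp

/-! ## Semantics of primitive recursion and minimisation -/

/-- Unwinding `Nat.rec` in the `Part` monad: `b` is the value at `n` of the primitive recursion with base `f a` and step
`g (a, y, ·)` iff there is a SEQUENCE of intermediate values `s 0, …, s n = b` obeying base and step. [folklore] -/
theorem mem_prec_iff (f g : ℕ →. ℕ) (a : ℕ) : ∀ (n b : ℕ),
    b ∈ (n.rec (f a) fun y IH => IH.bind fun i => g (Nat.pair a (Nat.pair y i)) : Part ℕ) ↔
      ∃ s : ℕ → ℕ, s 0 ∈ f a ∧ (∀ y < n, s (y + 1) ∈ g (Nat.pair a (Nat.pair y (s y)))) ∧ s n = b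
  | 0, b => by
      constructor
      · intro hb; exact ⟨fun _ => b, hb, fun y hy => absurd hy (Nat.not_lt_zero y), rfl⟩
      · rintro ⟨s, h0, -, rfl⟩; exact h0
  | n + 1, b => by
      rw [show (Nat.rec (f a) (fun y IH => IH.bind fun i => g (Nat.pair a (Nat.pair y i))) (n + 1) : Part ℕ) =
        (Nat.rec (f a) (fun y IH => IH.bind fun i => g (Nat.pair a (Nat.pair y i))) n : Part ℕ).bind
          fun i => g (Nat.pair a (Nat.pair n i)) from rfl, Part.mem_bind_iff]
      constructor
      · rintro ⟨i, hi, hb⟩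
        obtain ⟨s, h0, hstep, hsn⟩ := (mem_prec_iff f g a n i).1 hi
        refine ⟨Function.update s (n + 1) b, ?_, fun y hy => ?_, by simp⟩
        · rw [Function.update_of_ne (Nat.succ_ne_zero n).symm]; exact h0
        · rcases Nat.lt_succ_iff_lt_or_eq.1 hy with hy | rfl
          · rw [Function.update_of_ne (by omega), Function.update_of_ne (by omega)]; exact hstep y hy
          · rw [Function.update_self, Function.update_of_ne (by omega), hsn]; exact hb
      · rintro ⟨s, h0, hstep, rfl⟩
        exact ⟨s n, (mem_prec_iff f g a n (s n)).2 ⟨s, h0, fun y hy => hstep y (Nat.lt_succ_of_lt hy), rfl⟩,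
          hstep n (Nat.lt_succ_self n)⟩

/-- **Gödel's device**: the sequence of intermediate values of a primitive recursion may be taken of the form `Nat.beta c`
(β-lemma `exists_beta_eq`), so that "`b` is the value at `n`" becomes a statement about ONE natural number `c`.
[folklore] -/
theorem mem_prec_iff_beta (f g : ℕ →. ℕ) (a n b : ℕ) :
    b ∈ (n.rec (f a) fun y IH => IH.bind fun i => g (Nat.pair a (Nat.pair y i)) : Part ℕ) ↔
      ∃ c : ℕ, Nat.beta c 0 ∈ f a ∧ (∀ y < n, Nat.beta c (y + 1) ∈ g (Nat.pair a (Nat.pair y (Nat.beta c y)))) ∧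
        Nat.beta c n = b := by
  rw [mem_prec_iff]
  constructor
  · rintro ⟨s, h0, hstep, hsn⟩
    obtain ⟨c, hc⟩ := exists_beta_eq s n
    refine ⟨c, by rw [hc 0 (Nat.zero_le n)]; exact h0, fun y hy => ?_, by rw [hc n le_rfl, hsn]⟩
    rw [hc (y + 1) hy, hc y hy.le]; exact hstep y hy
  · rintro ⟨c, h0, hstep, hcn⟩
    exact ⟨Nat.beta c, h0, hstep, hcn⟩

/-- Membership in Kleene's minimisation as used by `Nat.Partrec.rfind`: `b` is the least `n` with `0 ∈ f (a, n)`, all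
earlier values being defined and non-zero (Mathlib `Nat.mem_rfind`). [folklore] -/
theorem mem_rfind_pair_iff (f : ℕ →. ℕ) (a b : ℕ) :
    b ∈ Nat.rfind (fun n => (fun m => m = 0) <$> f (Nat.pair a n)) ↔
      0 ∈ f (Nat.pair a b) ∧ ∀ m < b, ∃ k ∈ f (Nat.pair a m), k ≠ 0 := by
  rw [Nat.mem_rfind]
  simp only [Part.map_eq_map, Part.mem_map_iff, decide_eq_true_eq, exists_eq_right, decide_eq_false_iff_not]

/-- Membership in the applicative pairing used by `Nat.Partrec.pair`. [folklore] -/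
theorem mem_pair_seq_iff (f g : ℕ →. ℕ) (n b : ℕ) :
    b ∈ (Nat.pair <$> f n <*> g n) ↔ ∃ x ∈ f n, ∃ y ∈ g n, Nat.pair x y = b := by
  rw [seq_eq_bind_map]
  simp only [Part.bind_eq_bind, Part.mem_bind_iff, Part.map_eq_map, Part.mem_map_iff]
  constructor
  · rintro ⟨_, ⟨x, hx, rfl⟩, y, hy, rfl⟩; exact ⟨x, hx, y, hy, rfl⟩
  · rintro ⟨x, hx, y, hy, rfl⟩; exact ⟨_, ⟨x, hx, rfl⟩, y, hy, rfl⟩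

/-! ## The eight graph identities -/

/-- zero: `Γ[pure 0] = {0 ≤ v 0 ∧ v 1 = 0}`. -/
theorem graph_zero_eq : {t : Fin 2 → ℤ | 0 ≤ t 0 ∧ 0 ≤ t 1 ∧ (t 1).toNat ∈ (pure 0 : ℕ →. ℕ) (t 0).toNat} = {v : Fin 2 → ℤ | 0 ≤ v 0 ∧ v 1 = 0} := by
  ext v
  simp only [mem_setOf_eq]
  constructor
  · rintro ⟨h0, h1, h2⟩
    have h2' : (v 1).toNat = 0 := by simpa [pure, PFun.pure] using h2
    exact ⟨h0, by omega⟩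
  · rintro ⟨h0, h1⟩
    refine ⟨h0, by omega, ?_⟩
    simp [pure, PFun.pure, h1]

/-- succ: `Γ[succ] = {0 ≤ v 0 ∧ v 1 = v 0 + 1}`. -/
theorem graph_succ_eq : {t : Fin 2 → ℤ | 0 ≤ t 0 ∧ 0 ≤ t 1 ∧ (t 1).toNat ∈ (Nat.succ : ℕ →. ℕ) (t 0).toNat} = {v : Fin 2 → ℤ | 0 ≤ v 0 ∧ v 1 = v 0 + 1} := by
  ext v
  simp only [mem_setOf_eq, PFun.coe_val, Part.mem_some_iff, Nat.succ_eq_add_one]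
  constructor
  · rintro ⟨h0, h1, h2⟩; exact ⟨h0, by omega⟩
  · rintro ⟨h0, h1⟩; exact ⟨h0, by omega, by omega⟩

/-- left: `b = (unpair a).1 ↔ ∃ z, Nat.pair b z = a`. -/
theorem graph_left_eq : {t : Fin 2 → ℤ | 0 ≤ t 0 ∧ 0 ≤ t 1 ∧ (t 1).toNat ∈ (↑fun n : ℕ => n.unpair.1 : ℕ →. ℕ) (t 0).toNat} = {v : Fin 2 → ℤ | ∃ z : ℤ, ![v 1, z, v 0] ∈ {t : Fin 3 → ℤ | 0 ≤ t 0 ∧ 0 ≤ t 1 ∧ t 2 = (Nat.pair (t 0).toNat (t 1).toNat : ℤ)}} := by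
  ext v
  simp only [mem_setOf_eq, PFun.coe_val, Part.mem_some_iff, Matrix.cons_val_zero, Matrix.cons_val_one,
    Matrix.cons_val]
  constructor
  · rintro ⟨h0, h1, h2⟩
    refine ⟨((v 0).toNat.unpair.2 : ℤ), h1, Int.natCast_nonneg _, ?_⟩
    rw [Int.toNat_natCast, h2, Nat.pair_unpair, Int.toNat_of_nonneg h0]
  · rintro ⟨z, h1, hz, h0⟩
    refine ⟨by rw [h0]; exact Int.natCast_nonneg _, h1, ?_⟩
    rw [h0, Int.toNat_natCast, Nat.unpair_pair]

/-- right: `b = (unpair a).2 ↔ ∃ z, Nat.pair z b = a`. -/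
theorem graph_right_eq : {t : Fin 2 → ℤ | 0 ≤ t 0 ∧ 0 ≤ t 1 ∧ (t 1).toNat ∈ (↑fun n : ℕ => n.unpair.2 : ℕ →. ℕ) (t 0).toNat} = {v : Fin 2 → ℤ | ∃ z : ℤ, ![z, v 1, v 0] ∈ {t : Fin 3 → ℤ | 0 ≤ t 0 ∧ 0 ≤ t 1 ∧ t 2 = (Nat.pair (t 0).toNat (t 1).toNat : ℤ)}} := by
  ext v
  simp only [mem_setOf_eq, PFun.coe_val, Part.mem_some_iff, Matrix.cons_val_zero, Matrix.cons_val_one,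
    Matrix.cons_val]
  constructor
  · rintro ⟨h0, h1, h2⟩
    refine ⟨((v 0).toNat.unpair.1 : ℤ), Int.natCast_nonneg _, h1, ?_⟩
    rw [Int.toNat_natCast, h2, Nat.pair_unpair, Int.toNat_of_nonneg h0]
  · rintro ⟨z, hz, h1, h0⟩
    refine ⟨by rw [h0]; exact Int.natCast_nonneg _, h1, ?_⟩
    rw [h0, Int.toNat_natCast, Nat.unpair_pair]

/-- pair: `b ∈ (pair <$> f a <*> g a) ↔ ∃ x y, x ∈ f a ∧ y ∈ g a ∧ Nat.pair x y = b`. -/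
theorem graph_pair_eq (f g : ℕ →. ℕ) :
    {t : Fin 2 → ℤ | 0 ≤ t 0 ∧ 0 ≤ t 1 ∧ (t 1).toNat ∈ (fun n => Nat.pair <$> f n <*> g n : ℕ →. ℕ) (t 0).toNat} = {v : Fin 2 → ℤ | ∃ w : Fin 2 → ℤ,
      ![v 0, w 0] ∈ {t : Fin 2 → ℤ | 0 ≤ t 0 ∧ 0 ≤ t 1 ∧ (t 1).toNat ∈ f (t 0).toNat} ∧ ![v 0, w 1] ∈ {t : Fin 2 → ℤ | 0 ≤ t 0 ∧ 0 ≤ t 1 ∧ (t 1).toNat ∈ g (t 0).toNat} ∧ ![w 0, w 1, v 1] ∈ {t : Fin 3 → ℤ | 0 ≤ t 0 ∧ 0 ≤ t 1 ∧ t 2 = (Nat.pair (t 0).toNat (t 1).toNat : ℤ)}} := by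
  ext v
  simp only [mem_setOf_eq, Matrix.cons_val_zero, Matrix.cons_val_one, Matrix.cons_val, mem_pair_seq_iff]
  constructor
  · rintro ⟨h0, h1, x, hx, y, hy, hxy⟩
    refine ⟨![(x : ℤ), (y : ℤ)], ?_⟩
    simp only [Matrix.cons_val_zero, Matrix.cons_val_one, Int.toNat_natCast]
    exact ⟨⟨h0, Int.natCast_nonneg _, hx⟩, ⟨h0, Int.natCast_nonneg _, hy⟩, Int.natCast_nonneg _,
      Int.natCast_nonneg _, by rw [hxy, Int.toNat_of_nonneg h1]⟩
  · rintro ⟨w, ⟨h0, hw0, hx⟩, ⟨-, hw1, hy⟩, -, -, h1⟩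
    refine ⟨h0, by rw [h1]; exact Int.natCast_nonneg _, (w 0).toNat, hx, (w 1).toNat, hy, ?_⟩
    rw [h1, Int.toNat_natCast]

/-- comp: `b ∈ (g a >>= f) ↔ ∃ c, c ∈ g a ∧ b ∈ f c`. -/
theorem graph_comp_eq (f g : ℕ →. ℕ) :
    {t : Fin 2 → ℤ | 0 ≤ t 0 ∧ 0 ≤ t 1 ∧ (t 1).toNat ∈ (fun n => g n >>= f : ℕ →. ℕ) (t 0).toNat} = {v : Fin 2 → ℤ | ∃ c : ℤ, ![v 0, c] ∈ {t : Fin 2 → ℤ | 0 ≤ t 0 ∧ 0 ≤ t 1 ∧ (t 1).toNat ∈ g (t 0).toNat} ∧ ![c, v 1] ∈ {t : Fin 2 → ℤ | 0 ≤ t 0 ∧ 0 ≤ t 1 ∧ (t 1).toNat ∈ f (t 0).toNat}} := by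
  ext v
  simp only [mem_setOf_eq, Matrix.cons_val_zero, Matrix.cons_val_one, Part.bind_eq_bind, Part.mem_bind_iff]
  constructor
  · rintro ⟨h0, h1, c, hc, hb⟩
    refine ⟨(c : ℤ), ⟨h0, Int.natCast_nonneg _, by rw [Int.toNat_natCast]; exact hc⟩, Int.natCast_nonneg _, h1, ?_⟩
    rw [Int.toNat_natCast]; exact hb
  · rintro ⟨c, ⟨h0, hc, hcg⟩, -, h1, hb⟩
    exact ⟨h0, h1, c.toNat, hcg, hb⟩

/-- rfind: the graph of Kleene minimisation as a first-order condition over `ℤ`. -/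
theorem graph_rfind_eq (f : ℕ →. ℕ) :
    {t : Fin 2 → ℤ | 0 ≤ t 0 ∧ 0 ≤ t 1 ∧ (t 1).toNat ∈ (fun a => Nat.rfind fun n => (fun m => m = 0) <$> f (Nat.pair a n) : ℕ →. ℕ) (t 0).toNat} = {v : Fin 2 → ℤ | 0 ≤ v 1 ∧
      (∃ q : ℤ, ![v 0, v 1, q] ∈ {t : Fin 3 → ℤ | 0 ≤ t 0 ∧ 0 ≤ t 1 ∧ t 2 = (Nat.pair (t 0).toNat (t 1).toNat : ℤ)} ∧ ![q, 0] ∈ {t : Fin 2 → ℤ | 0 ≤ t 0 ∧ 0 ≤ t 1 ∧ (t 1).toNat ∈ f (t 0).toNat}) ∧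
      ∀ m : ℤ, 0 ≤ m → m < v 1 → ∃ w : Fin 2 → ℤ, ![v 0, m, w 0] ∈ {t : Fin 3 → ℤ | 0 ≤ t 0 ∧ 0 ≤ t 1 ∧ t 2 = (Nat.pair (t 0).toNat (t 1).toNat : ℤ)} ∧ ![w 0, w 1] ∈ {t : Fin 2 → ℤ | 0 ≤ t 0 ∧ 0 ≤ t 1 ∧ (t 1).toNat ∈ f (t 0).toNat} ∧ w 1 ≠ 0} := by
  ext v
  simp only [mem_setOf_eq, Matrix.cons_val_zero, Matrix.cons_val_one, Matrix.cons_val, mem_rfind_pair_iff,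
    Int.toNat_zero]
  constructor
  · rintro ⟨h0, h1, hzero, hmin⟩
    refine ⟨h1, ⟨(Nat.pair (v 0).toNat (v 1).toNat : ℤ), ⟨h0, h1, rfl⟩, Int.natCast_nonneg _, le_rfl, ?_⟩, ?_⟩
    · rw [Int.toNat_natCast]; exact hzero
    · intro m hm hlt
      obtain ⟨m', rfl⟩ := Int.eq_ofNat_of_zero_le hm
      have hlt' : m' < (v 1).toNat := by omega
      obtain ⟨k, hk, hk0⟩ := hmin m' hlt'
      refine ⟨![(Nat.pair (v 0).toNat m' : ℤ), (k : ℤ)], ?_⟩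
      simp only [Matrix.cons_val_zero, Matrix.cons_val_one, Int.toNat_natCast]
      exact ⟨⟨h0, hm, by trivial⟩, ⟨Int.natCast_nonneg _, Int.natCast_nonneg _, hk⟩, by exact_mod_cast hk0⟩
  · rintro ⟨h1, ⟨q, ⟨h0, -, hq⟩, -, -, hzero⟩, hmin⟩
    refine ⟨h0, h1, by rw [hq, Int.toNat_natCast] at hzero; exact hzero, fun m hm => ?_⟩
    obtain ⟨w, ⟨-, -, hw0⟩, ⟨-, hw1, hk⟩, hne⟩ := hmin (m : ℤ) (Int.natCast_nonneg m) (by omega)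
    refine ⟨(w 1).toNat, ?_, by omega⟩
    rw [hw0, Int.toNat_natCast, Int.toNat_natCast] at hk
    exact hk

/-- prec: the graph of a primitive recursion as a first-order condition over `ℤ` — Gödel's β-function names the sequence of
intermediate values (`mem_prec_iff_beta`); witnesses `u = (a, n, c)` (argument halves and the β-code), and for each `y < n`
`w = (β c y, β c (y+1), pair y (β c y), pair a (pair y (β c y)))`. [folklore] -/
theorem graph_prec_eq (f g : ℕ →. ℕ) :
    {t : Fin 2 → ℤ | 0 ≤ t 0 ∧ 0 ≤ t 1 ∧ (t 1).toNat ∈ (Nat.unpaired fun a n => n.rec (f a) fun y IH => do let i ← IH; g (Nat.pair a (Nat.pair y i)) : ℕ →. ℕ) (t 0).toNat} =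
      {v : Fin 2 → ℤ | ∃ u : Fin 3 → ℤ, ![u 0, u 1, v 0] ∈ {t : Fin 3 → ℤ | 0 ≤ t 0 ∧ 0 ≤ t 1 ∧ t 2 = (Nat.pair (t 0).toNat (t 1).toNat : ℤ)} ∧
        (∃ t : ℤ, ![u 2, 0, t] ∈ {t : Fin 3 → ℤ | 0 ≤ t 0 ∧ 0 ≤ t 1 ∧ t 2 = (Nat.beta (t 0).toNat (t 1).toNat : ℤ)} ∧ ![u 0, t] ∈ {t : Fin 2 → ℤ | 0 ≤ t 0 ∧ 0 ≤ t 1 ∧ (t 1).toNat ∈ f (t 0).toNat}) ∧ ![u 2, u 1, v 1] ∈ {t : Fin 3 → ℤ | 0 ≤ t 0 ∧ 0 ≤ t 1 ∧ t 2 = (Nat.beta (t 0).toNat (t 1).toNat : ℤ)} ∧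
        ∀ y : ℤ, 0 ≤ y → y < u 1 → ∃ w : Fin 4 → ℤ, ![u 2, y, w 0] ∈ {t : Fin 3 → ℤ | 0 ≤ t 0 ∧ 0 ≤ t 1 ∧ t 2 = (Nat.beta (t 0).toNat (t 1).toNat : ℤ)} ∧ ![u 2, y + 1, w 1] ∈ {t : Fin 3 → ℤ | 0 ≤ t 0 ∧ 0 ≤ t 1 ∧ t 2 = (Nat.beta (t 0).toNat (t 1).toNat : ℤ)} ∧
          ![y, w 0, w 2] ∈ {t : Fin 3 → ℤ | 0 ≤ t 0 ∧ 0 ≤ t 1 ∧ t 2 = (Nat.pair (t 0).toNat (t 1).toNat : ℤ)} ∧ ![u 0, w 2, w 3] ∈ {t : Fin 3 → ℤ | 0 ≤ t 0 ∧ 0 ≤ t 1 ∧ t 2 = (Nat.pair (t 0).toNat (t 1).toNat : ℤ)} ∧ ![w 3, w 1] ∈ {t : Fin 2 → ℤ | 0 ≤ t 0 ∧ 0 ≤ t 1 ∧ (t 1).toNat ∈ g (t 0).toNat}} := by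
  ext v
  simp only [mem_setOf_eq, Matrix.cons_val_zero, Matrix.cons_val_one, Matrix.cons_val, Nat.unpaired,
    Part.bind_eq_bind, Int.toNat_zero]
  constructor
  · rintro ⟨h0, h1, hb⟩
    set a := (v 0).toNat.unpair.1 with ha
    set n := (v 0).toNat.unpair.2 with hn
    obtain ⟨c, hc0, hstep, hcn⟩ := (mem_prec_iff_beta f g a n _).1 hb
    refine ⟨![(a : ℤ), (n : ℤ), (c : ℤ)], ?_⟩
    simp only [Matrix.cons_val_zero, Matrix.cons_val_one, Matrix.cons_val, Int.toNat_natCast]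
    refine ⟨⟨Int.natCast_nonneg _, Int.natCast_nonneg _, ?_⟩, ⟨(Nat.beta c 0 : ℤ), ⟨Int.natCast_nonneg _, le_rfl,
      rfl⟩, Int.natCast_nonneg _, Int.natCast_nonneg _, by rw [Int.toNat_natCast]; exact hc0⟩,
      ⟨Int.natCast_nonneg _, Int.natCast_nonneg _, by rw [hcn, Int.toNat_of_nonneg h1]⟩, ?_⟩
    · rw [ha, hn, Nat.pair_unpair, Int.toNat_of_nonneg h0]
    · intro y hy hlt
      obtain ⟨y', rfl⟩ := Int.eq_ofNat_of_zero_le hy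
      have hlt' : y' < n := by exact_mod_cast hlt
      refine ⟨![(Nat.beta c y' : ℤ), (Nat.beta c (y' + 1) : ℤ), (Nat.pair y' (Nat.beta c y') : ℤ),
        (Nat.pair a (Nat.pair y' (Nat.beta c y')) : ℤ)], ?_⟩
      simp only [Matrix.cons_val_zero, Matrix.cons_val_one, Matrix.cons_val, Int.toNat_natCast]
      refine ⟨⟨Int.natCast_nonneg _, hy, by trivial⟩, ⟨Int.natCast_nonneg _, by omega, ?_⟩,
        ⟨hy, Int.natCast_nonneg _, by trivial⟩, ⟨Int.natCast_nonneg _, Int.natCast_nonneg _, by trivial⟩,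
        Int.natCast_nonneg _, Int.natCast_nonneg _, hstep y' hlt'⟩
      have e : ((y' : ℤ) + 1).toNat = y' + 1 := by omega
      rw [e]
  · rintro ⟨u, ⟨hu0, hu1, hv0⟩, ⟨t, ⟨hu2, -, ht⟩, -, ht0, htf⟩, ⟨-, -, hv1⟩, hall⟩
    obtain ⟨a, ha⟩ := Int.eq_ofNat_of_zero_le hu0
    obtain ⟨n, hn⟩ := Int.eq_ofNat_of_zero_le hu1
    obtain ⟨c, hc⟩ := Int.eq_ofNat_of_zero_le hu2
    simp only [ha, hn, hc, Int.toNat_natCast] at hv0 hv1 ht htf hall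
    refine ⟨by rw [hv0]; exact Int.natCast_nonneg _, by rw [hv1]; exact Int.natCast_nonneg _, ?_⟩
    rw [hv0, hv1, Int.toNat_natCast, Int.toNat_natCast, Nat.unpair_pair]
    refine (mem_prec_iff_beta f g a n _).2 ⟨c, ?_, fun y hy => ?_, rfl⟩
    · rw [ht, Int.toNat_natCast] at htf; exact htf
    · obtain ⟨w, ⟨-, -, hw0⟩, ⟨-, -, hw1⟩, ⟨-, -, hw2⟩, ⟨-, -, hw3⟩, -, -, hg⟩ :=
        hall (y : ℤ) (Int.natCast_nonneg y) (by exact_mod_cast hy)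
      have e : ((y : ℤ) + 1).toNat = y + 1 := by omega
      rw [Int.toNat_natCast] at hw0 hw2
      rw [e] at hw1
      rw [hw3, hw1, Int.toNat_natCast, Int.toNat_natCast, hw2, Int.toNat_natCast, hw0, Int.toNat_natCast] at hg
      exact hg

/-! ## Registered form -/

/-- Registered helper stub `mem_prec_iff_beta_std` of crux stmt-Schanuel-0969 (line kernel-arithmetic-selection, S8): Gödel's
β-function device for primitive recursion in the `Part` monad — "`b` is the value at `n` of the recursion with base `f a` and
step `g (a, y, ·)`" is a first-order statement about one code `c` (explicit-binder form of `mem_prec_iff_beta`). [folklore] -/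
theorem mem_prec_iff_beta_std : ∀ (f g : ℕ →. ℕ) (a n b : ℕ), (b ∈ (Nat.rec (f a) (fun (y : ℕ) (IH : Part ℕ) => IH.bind fun i => g (Nat.pair a (Nat.pair y i))) n : Part ℕ) ↔ ∃ c : ℕ, Nat.beta c 0 ∈ f a ∧ (∀ y < n, Nat.beta c (y + 1) ∈ g (Nat.pair a (Nat.pair y (Nat.beta c y)))) ∧ Nat.beta c n = b) := by
  intro f g a n b
  exact mem_prec_iff_beta f g a n b

end Summit.Schanuel.Schanuel.Cruxes.MinimalCounterexampleInAcl.KernelArithmeticSelection
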